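import Literature.MathematicalPhysics.QuantumLattice.ReflectedCorrelationLogConvexity
import HarnessLib

/-!
# Reflected correlations of translates: polarised Cauchy–Schwarz and finite combinations

Sequel of `ReflectedCorrelationPolarisation` / `ReflectedCorrelationLogConvexity` (same abstract bookkeeping:
a finite measure `μ` on `Ω`, a measurable reflection `Θ`, a `μ`-preserving "time shift" `τ` with measurable
left inverse `σ` intertwined by `τ ∘ Θ = Θ ∘ σ`, a class `Good` of bounded measurable observables closed
under `X + c • Y` with `0 ≤ osVar Z`).  Where the log-convexity file treats the DIAGONAL `osCorr τ^m X X`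
(Hankel chain), this file supplies the POLARISED statements that control a finite linear combination of
translates of ONE observable by the diagonal pair alone:

* `osCorr_comp_comp_eq_of_comm` — invariance of `osCorr` under a `μ`-preserving symmetry `g` commuting with
  `Θ` and `τ` (on a lattice: spatial translations): `osCorr (X ∘ g) (Y ∘ g) = osCorr X Y`;
* `osCorr_iterate_comp_iterate` — time shifts of both observables are absorbed into the separation:
  `osCorr τ^m (X ∘ τ^s) (Y ∘ τ^s') = osCorr τ^(m+s+s') X Y`;
* **`norm_osCorr_iterate_sq_le`** — the polarised Cauchy–Schwarz inequality at the separations `(0, 2m)`: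
  `‖osCorr τ^m X Y‖² ≤ osVar X · Re osCorr τ^(2m) Y Y` for good `X, Y` with `Y ∘ τ^m` good (Cauchy–Schwarz
  for the pair `(X, Y ∘ τ^m)` and the shift identity) — so a cross pair of translates of one observable `O`
  in a translation-invariant state is bounded by the diagonal pair `(O, O)` at the SAME rate;
* `osCorr_add_left/right`, `osCorr_smul_left/right`, `osCorr_sum_left/right`, `osCorr_sum_sum` —
  sesquilinearity of `osCorr` over finite sums of bounded measurable observables;
* `osCorr_add_const` (constants drop out on a probability space), `osCorr_ofReal` (real observables).

All statements here are proved.  Consumer: the one-leg far bound of the Yang–Mills crux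
`GapToContinuum` (`Summits/…/Theorems/LangevinControlUVGapToContinuumOneLegFarBound.lean`).

References: K. Osterwalder, E. Seiler, Ann. Phys. 110 (1978) 440, §2; J. Glimm, A. Jaffe, Quantum Physics
(1987), §6.1; J. Fröhlich, R. Israel, E. H. Lieb, B. Simon, Commun. Math. Phys. 62 (1978) 1, §2 (Schwarz
inequality for RP states).
-/

open scoped ComplexConjugate
open Filter MeasureTheory Finset

noncomputable section

namespace Literature.MathematicalPhysics.QuantumLattice

/-! ## Symmetries, shift absorption, polarised Cauchy–Schwarz, finite sums -/

section Translates

variable {Ω : Type*} [MeasurableSpace Ω] {μ : Measure Ω} {Θ τ σ : Ω → Ω}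

/-- **Invariance of the reflected correlation under a commuting symmetry.** If `g` preserves `μ`
and commutes with the reflection `Θ` and the shift `τ`, then
`osCorr (X ∘ g) (Y ∘ g) = osCorr X Y` (on the torus: spatial translations). [folklore] -/
theorem osCorr_comp_comp_eq_of_comm {g : Ω → Ω} (hg : MeasurePreserving g μ μ) (hΘ : Measurable Θ)
    (hτ : Measurable τ) (hΘg : ∀ ω, Θ (g ω) = g (Θ ω)) (hτg : ∀ ω, τ (g ω) = g (τ ω))
    {X Y : Ω → ℂ} (hX : Measurable X) (hY : Measurable Y) :
    osCorr μ Θ τ (X ∘ g) (Y ∘ g) = osCorr μ Θ τ X Y := by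
  unfold osCorr
  simp only [Function.comp_apply]
  have h1 : ∫ ω, conj (X (g (Θ ω))) * Y (g (τ ω)) ∂μ = ∫ ω, conj (X (Θ ω)) * Y (τ ω) ∂μ := by
    have hF : Measurable fun ω => conj (X (Θ ω)) * Y (τ ω) :=
      (Complex.continuous_conj.measurable.comp (hX.comp hΘ)).mul (hY.comp hτ)
    rw [← integral_comp_eq_of_measurePreserving hg hF]
    refine integral_congr_ae (Eventually.of_forall fun ω => ?_)
    simp only [hΘg, hτg]
  rw [h1, integral_comp_eq_of_measurePreserving hg hX, integral_comp_eq_of_measurePreserving hg hY]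

/-- **Time shifts of both observables are absorbed into the separation.** For a `μ`-preserving shift
`τ` with measurable left inverse `σ` intertwined with the reflection by `τ ∘ Θ = Θ ∘ σ`,
`osCorr τ^m (X ∘ τ^s) (Y ∘ τ^s') = osCorr τ^(m + s + s') X Y`: reflecting moves the shift of the
first observable to the other side. [cite: OsterwalderSeiler1978, §2] -/
theorem osCorr_iterate_comp_iterate (hΘ : Measurable Θ) (hτ : MeasurePreserving τ μ μ)
    (hσ : Measurable σ) (hΘτ : ∀ ω, τ (Θ ω) = Θ (σ ω)) (hστ : ∀ ω, σ (τ ω) = ω)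
    {X Y : Ω → ℂ} (hX : Measurable X) (hY : Measurable Y) (m s s' : ℕ) :
    osCorr μ Θ (τ^[m]) (X ∘ τ^[s]) (Y ∘ τ^[s']) = osCorr μ Θ (τ^[m + s + s']) X Y := by
  unfold osCorr
  simp only [Function.comp_apply]
  rw [integral_comp_eq_of_measurePreserving (hτ.iterate s) hX,
    integral_comp_eq_of_measurePreserving (hτ.iterate s') hY]
  congr 1
  -- `∫ conj X(τ^s Θ ω) Y(τ^s' τ^m ω) = ∫ conj X(Θ σ^s ω) Y(τ^(s'+m) ω) = ∫ conj X(Θ ω') Y(τ^(s'+m+s) ω')`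
  have hF : Measurable fun ω => conj (X (Θ ((σ^[s]) ω))) * Y ((τ^[s' + m]) ω) :=
    (Complex.continuous_conj.measurable.comp (hX.comp (hΘ.comp (hσ.iterate s)))).mul
      (hY.comp (hτ.measurable.iterate (s' + m)))
  have h := integral_comp_eq_of_measurePreserving (hτ.iterate s) hF
  simp only [iterate_leftInverse hστ s] at h
  have e1 : ∀ ω, conj (X ((τ^[s]) (Θ ω))) * Y ((τ^[s']) ((τ^[m]) ω)) =
      conj (X (Θ ((σ^[s]) ω))) * Y ((τ^[s' + m]) ω) := fun ω => by
    rw [iterate_apply_reflect hΘτ s ω, Function.iterate_add_apply]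
  have e2 : ∀ ω, conj (X (Θ ω)) * Y ((τ^[s' + m]) ((τ^[s]) ω)) =
      conj (X (Θ ω)) * Y ((τ^[m + s + s']) ω) := fun ω => by
    rw [← Function.iterate_add_apply]
    congr 3; omega
  simp_rw [e1, ← h, e2]

variable [IsFiniteMeasure μ]

/-- **Polarised Cauchy–Schwarz at the separations `(0, 2m)`.** On a class `Good` of bounded measurable
functions closed under `X + c • Y` with `0 ≤ osVar Z` (reflection positivity), for good `X`, `Y` with
`Y ∘ τ^m` good: `‖osCorr τ^m X Y‖² ≤ osVar X · Re osCorr τ^(2m) Y Y` — Cauchy–Schwarz for the pair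
`(X, Y ∘ τ^m)` and the shift identity `osVar (Y ∘ τ^m) = Re osCorr τ^(2m) Y Y`. [cite: FrohlichIsraelLiebSimon1978, §2] [cite: GlimmJaffe1987, §6.1] -/
theorem norm_osCorr_iterate_sq_le (hΘm : Measurable Θ) (hΘ : MeasurePreserving Θ μ μ)
    (hΘΘ : ∀ ω, Θ (Θ ω) = ω) (hτ : MeasurePreserving τ μ μ) (hσ : Measurable σ)
    (hΘτ : ∀ ω, τ (Θ ω) = Θ (σ ω)) (hστ : ∀ ω, σ (τ ω) = ω)
    {Good : (Ω → ℂ) → Prop} (hmeas : ∀ X, Good X → Measurable X)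
    (hbdd : ∀ X, Good X → ∃ B, ∀ ω, ‖X ω‖ ≤ B)
    (hadd : ∀ X Y (c : ℂ), Good X → Good Y → Good (X + c • Y))
    (hvar : ∀ Z, Good Z → 0 ≤ osVar μ Θ Z) {X Y : Ω → ℂ} (hX : Good X) (hY : Good Y) (m : ℕ)
    (hYτ : Good (Y ∘ τ^[m])) :
    ‖osCorr μ Θ (τ^[m]) X Y‖ ^ 2 ≤ osVar μ Θ X * (osCorr μ Θ (τ^[2 * m]) Y Y).re := by
  have hYm := hmeas Y hY
  rw [osCorr_eq_osCorr_id_comp (hτ.iterate m) X hYm]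
  refine (norm_osCorr_id_sq_le hΘm hΘ hΘΘ hmeas hbdd hadd hvar hX hYτ).trans (le_of_eq ?_)
  congr 1
  unfold osVar
  rw [osCorr_id_comp_comp (hτ.iterate m) (hσ.iterate m) hΘm (iterate_apply_reflect hΘτ m)
    (iterate_leftInverse hστ m) hYm hYm, ← Function.iterate_add, two_mul]

omit [IsFiniteMeasure μ] in
/-- A finite sum of measurable functions (as a function) is measurable. [folklore] -/
theorem measurable_finset_sum_fun {ι : Type*} (t : Finset ι) {f : ι → Ω → ℂ}
    (hf : ∀ i ∈ t, Measurable (f i)) : Measurable (∑ i ∈ t, f i) := by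
  have h : (∑ i ∈ t, f i) = fun ω => ∑ i ∈ t, f i ω := by
    funext ω; simp [Finset.sum_apply]
  rw [h]; exact Finset.measurable_sum t hf

omit [MeasurableSpace Ω] [IsFiniteMeasure μ] in
/-- A finite sum of bounded functions is bounded. [folklore] -/
theorem exists_bound_sum {ι : Type*} (t : Finset ι) {X : ι → Ω → ℂ}
    (hb : ∀ i ∈ t, ∃ B, ∀ ω, ‖X i ω‖ ≤ B) : ∃ B, ∀ ω, ‖(∑ i ∈ t, X i) ω‖ ≤ B := by
  classical
  induction t using Finset.induction_on with
  | empty => exact ⟨0, fun ω => by simp⟩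
  | insert i t hi ih =>
    obtain ⟨B, hB⟩ := hb i (mem_insert_self _ _)
    obtain ⟨B', hB'⟩ := ih fun j hj => hb j (mem_insert_of_mem hj)
    refine ⟨B + B', fun ω => ?_⟩
    rw [sum_insert hi, Pi.add_apply]
    exact (norm_add_le _ _).trans (add_le_add (hB ω) (hB' ω))

/-- Additivity of `osCorr` in the first (conjugate-linear) argument. [folklore] -/
theorem osCorr_add_left (hΘ : Measurable Θ) (hτ : Measurable τ) {X X' Y : Ω → ℂ}
    (hX : Measurable X) (hbX : ∃ B, ∀ ω, ‖X ω‖ ≤ B) (hX' : Measurable X')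
    (hbX' : ∃ B, ∀ ω, ‖X' ω‖ ≤ B) (hY : Measurable Y) (hbY : ∃ B, ∀ ω, ‖Y ω‖ ≤ B) :
    osCorr μ Θ τ (X + X') Y = osCorr μ Θ τ X Y + osCorr μ Θ τ X' Y := by
  unfold osCorr
  simp only [Pi.add_apply, map_add, add_mul]
  rw [integral_add (integrable_conj_comp_mul_comp hΘ hτ hX hbX hY hbY)
      (integrable_conj_comp_mul_comp hΘ hτ hX' hbX' hY hbY),
    integral_add (integrable_of_measurable_bounded hX hbX) (integrable_of_measurable_bounded hX' hbX')]
  simp only [map_add]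
  ring

omit [IsFiniteMeasure μ] in
/-- Conjugate homogeneity of `osCorr` in the first argument. [folklore] -/
theorem osCorr_smul_left (c : ℂ) (X Y : Ω → ℂ) :
    osCorr μ Θ τ (c • X) Y = conj c * osCorr μ Θ τ X Y := by
  unfold osCorr
  simp only [Pi.smul_apply, smul_eq_mul, map_mul, mul_assoc]
  rw [integral_const_mul, integral_const_mul, map_mul]
  ring

/-- Additivity of `osCorr` in the second (linear) argument. [folklore] -/
theorem osCorr_add_right (hΘ : Measurable Θ) (hτ : Measurable τ) {X Y Y' : Ω → ℂ}
    (hX : Measurable X) (hbX : ∃ B, ∀ ω, ‖X ω‖ ≤ B) (hY : Measurable Y) (hbY : ∃ B, ∀ ω, ‖Y ω‖ ≤ B)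
    (hY' : Measurable Y') (hbY' : ∃ B, ∀ ω, ‖Y' ω‖ ≤ B) :
    osCorr μ Θ τ X (Y + Y') = osCorr μ Θ τ X Y + osCorr μ Θ τ X Y' := by
  unfold osCorr
  simp only [Pi.add_apply, mul_add]
  rw [integral_add (integrable_conj_comp_mul_comp hΘ hτ hX hbX hY hbY)
      (integrable_conj_comp_mul_comp hΘ hτ hX hbX hY' hbY'),
    integral_add (integrable_of_measurable_bounded hY hbY) (integrable_of_measurable_bounded hY' hbY')]
  ring

omit [IsFiniteMeasure μ] in
/-- Homogeneity of `osCorr` in the second argument. [folklore] -/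
theorem osCorr_smul_right (c : ℂ) (X Y : Ω → ℂ) :
    osCorr μ Θ τ X (c • Y) = c * osCorr μ Θ τ X Y := by
  unfold osCorr
  simp only [Pi.smul_apply, smul_eq_mul]
  have e : ∀ ω, conj (X (Θ ω)) * (c * Y (τ ω)) = c * (conj (X (Θ ω)) * Y (τ ω)) := fun ω => by ring
  simp_rw [e]
  rw [integral_const_mul, integral_const_mul]
  ring

omit [IsFiniteMeasure μ] in
/-- `osCorr` vanishes when the first argument is `0`. [folklore] -/
@[simp] theorem osCorr_zero_left (Y : Ω → ℂ) : osCorr μ Θ τ 0 Y = 0 := by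
  simp [osCorr]

omit [IsFiniteMeasure μ] in
/-- `osCorr` vanishes when the second argument is `0`. [folklore] -/
@[simp] theorem osCorr_zero_right (X : Ω → ℂ) : osCorr μ Θ τ X 0 = 0 := by
  simp [osCorr]

/-- `osCorr` of a finite linear combination in the first argument. [folklore] -/
theorem osCorr_sum_left (hΘ : Measurable Θ) (hτ : Measurable τ) {ι : Type*} (t : Finset ι)
    {X : ι → Ω → ℂ} (a : ι → ℂ) (hX : ∀ i ∈ t, Measurable (X i)) (hbX : ∀ i ∈ t, ∃ B, ∀ ω, ‖X i ω‖ ≤ B)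
    {Y : Ω → ℂ} (hY : Measurable Y) (hbY : ∃ B, ∀ ω, ‖Y ω‖ ≤ B) :
    osCorr μ Θ τ (∑ i ∈ t, a i • X i) Y = ∑ i ∈ t, conj (a i) * osCorr μ Θ τ (X i) Y := by
  classical
  induction t using Finset.induction_on with
  | empty => simp
  | insert i t hi ih =>
    have hXi := hX i (mem_insert_self _ _)
    have hbXi := hbX i (mem_insert_self _ _)
    have hXt : ∀ j ∈ t, Measurable (X j) := fun j hj => hX j (mem_insert_of_mem hj)
    have hbXt : ∀ j ∈ t, ∃ B, ∀ ω, ‖X j ω‖ ≤ B := fun j hj => hbX j (mem_insert_of_mem hj)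
    rw [sum_insert hi, sum_insert hi, osCorr_add_left hΘ hτ (hXi.const_smul (a i)) ?_ ?_ ?_ hY hbY,
      osCorr_smul_left, ih hXt hbXt]
    · obtain ⟨B, hB⟩ := hbXi
      exact ⟨‖a i‖ * B, fun ω => by
        rw [Pi.smul_apply, smul_eq_mul, norm_mul]
        exact mul_le_mul_of_nonneg_left (hB ω) (norm_nonneg _)⟩
    · exact measurable_finset_sum_fun _ fun j hj => (hXt j hj).const_smul (a j)
    · exact exists_bound_sum t fun j hj => by
        obtain ⟨B, hB⟩ := hbXt j hj
        exact ⟨‖a j‖ * B, fun ω => by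
          rw [Pi.smul_apply, smul_eq_mul, norm_mul]
          exact mul_le_mul_of_nonneg_left (hB ω) (norm_nonneg _)⟩

/-- `osCorr` of a finite linear combination in the second argument. [folklore] -/
theorem osCorr_sum_right (hΘ : Measurable Θ) (hτ : Measurable τ) {ι : Type*} (t : Finset ι)
    {X : Ω → ℂ} (hX : Measurable X) (hbX : ∃ B, ∀ ω, ‖X ω‖ ≤ B)
    {Y : ι → Ω → ℂ} (b : ι → ℂ) (hY : ∀ i ∈ t, Measurable (Y i)) (hbY : ∀ i ∈ t, ∃ B, ∀ ω, ‖Y i ω‖ ≤ B) :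
    osCorr μ Θ τ X (∑ i ∈ t, b i • Y i) = ∑ i ∈ t, b i * osCorr μ Θ τ X (Y i) := by
  classical
  induction t using Finset.induction_on with
  | empty => simp
  | insert i t hi ih =>
    have hYi := hY i (mem_insert_self _ _)
    have hbYi := hbY i (mem_insert_self _ _)
    have hYt : ∀ j ∈ t, Measurable (Y j) := fun j hj => hY j (mem_insert_of_mem hj)
    have hbYt : ∀ j ∈ t, ∃ B, ∀ ω, ‖Y j ω‖ ≤ B := fun j hj => hbY j (mem_insert_of_mem hj)
    rw [sum_insert hi, sum_insert hi, osCorr_add_right hΘ hτ hX hbX (hYi.const_smul (b i)) ?_ ?_ ?_,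
      osCorr_smul_right, ih hYt hbYt]
    · obtain ⟨B, hB⟩ := hbYi
      exact ⟨‖b i‖ * B, fun ω => by
        rw [Pi.smul_apply, smul_eq_mul, norm_mul]
        exact mul_le_mul_of_nonneg_left (hB ω) (norm_nonneg _)⟩
    · exact measurable_finset_sum_fun _ fun j hj => (hYt j hj).const_smul (b j)
    · exact exists_bound_sum t fun j hj => by
        obtain ⟨B, hB⟩ := hbYt j hj
        exact ⟨‖b j‖ * B, fun ω => by
          rw [Pi.smul_apply, smul_eq_mul, norm_mul]
          exact mul_le_mul_of_nonneg_left (hB ω) (norm_nonneg _)⟩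

/-- **Sesquilinearity of `osCorr` over finite sums**:
`osCorr (Σ_i a_i X_i) (Σ_j b_j Y_j) = Σ_i Σ_j conj(a_i) b_j osCorr X_i Y_j`. [folklore] -/
theorem osCorr_sum_sum (hΘ : Measurable Θ) (hτ : Measurable τ) {ι κ : Type*} (t : Finset ι)
    (u : Finset κ) {X : ι → Ω → ℂ} (a : ι → ℂ) (hX : ∀ i ∈ t, Measurable (X i))
    (hbX : ∀ i ∈ t, ∃ B, ∀ ω, ‖X i ω‖ ≤ B) {Y : κ → Ω → ℂ} (b : κ → ℂ)
    (hY : ∀ j ∈ u, Measurable (Y j)) (hbY : ∀ j ∈ u, ∃ B, ∀ ω, ‖Y j ω‖ ≤ B) :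
    osCorr μ Θ τ (∑ i ∈ t, a i • X i) (∑ j ∈ u, b j • Y j) =
      ∑ i ∈ t, ∑ j ∈ u, conj (a i) * b j * osCorr μ Θ τ (X i) (Y j) := by
  rw [osCorr_sum_left hΘ hτ t a hX hbX (measurable_finset_sum_fun _ fun j hj => (hY j hj).const_smul (b j))
    (exists_bound_sum u fun j hj => by
      obtain ⟨B, hB⟩ := hbY j hj
      exact ⟨‖b j‖ * B, fun ω => by
        rw [Pi.smul_apply, smul_eq_mul, norm_mul]
        exact mul_le_mul_of_nonneg_left (hB ω) (norm_nonneg _)⟩)]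
  refine sum_congr rfl fun i hi => ?_
  rw [osCorr_sum_right hΘ hτ u (hX i hi) (hbX i hi) b hY hbY, mul_sum]
  refine sum_congr rfl fun j _ => ?_
  ring

end Translates

/-! ## Constants and real observables -/

section Constants

variable {Ω : Type*} [MeasurableSpace Ω] {μ : Measure Ω} {Θ τ : Ω → Ω}

/-- **Constants drop out of connected correlations**: for `μ`-preserving `Θ`, `τ` on a probability
space, `osCorr (Y + k) (Y' + k') = osCorr Y Y'` (additive renormalisations of lattice fields are
invisible in `osCorr`). [folklore] -/
theorem osCorr_add_const [IsProbabilityMeasure μ] (hΘ : MeasurePreserving Θ μ μ)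
    (hτ : MeasurePreserving τ μ μ) {Y Y' : Ω → ℂ} (hY : Measurable Y) (hbY : ∃ B, ∀ ω, ‖Y ω‖ ≤ B)
    (hY' : Measurable Y') (hbY' : ∃ B, ∀ ω, ‖Y' ω‖ ≤ B) (k k' : ℂ) :
    osCorr μ Θ τ (Y + fun _ => k) (Y' + fun _ => k') = osCorr μ Θ τ Y Y' := by
  have hck : Measurable (fun _ : Ω => k) := measurable_const
  have hck' : Measurable (fun _ : Ω => k') := measurable_const
  have hbk : ∃ B, ∀ ω : Ω, ‖(fun _ : Ω => k) ω‖ ≤ B := ⟨‖k‖, fun _ => le_rfl⟩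
  have hbk' : ∃ B, ∀ ω : Ω, ‖(fun _ : Ω => k') ω‖ ≤ B := ⟨‖k'‖, fun _ => le_rfl⟩
  rw [osCorr_add_left hΘ.measurable hτ.measurable hY hbY hck hbk (hY'.add hck') ?_,
    osCorr_add_right hΘ.measurable hτ.measurable hY hbY hY' hbY' hck' hbk',
    osCorr_add_right hΘ.measurable hτ.measurable hck hbk hY' hbY' hck' hbk']
  · have h1 : osCorr μ Θ τ Y (fun _ => k') = 0 := by
      unfold osCorr
      have e : ∫ a, conj (Y (Θ a)) ∂μ = ∫ a, conj (Y a) ∂μ :=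
        integral_comp_eq_of_measurePreserving hΘ (Complex.continuous_conj.measurable.comp hY)
      rw [integral_const, integral_mul_const, probReal_univ, one_smul, ← integral_conj, e]
      ring
    have h2 : osCorr μ Θ τ (fun _ => k) Y' = 0 := by
      unfold osCorr
      rw [integral_const, integral_const_mul, probReal_univ, one_smul,
        integral_comp_eq_of_measurePreserving hτ hY']
      ring
    have h3 : osCorr μ Θ τ (fun _ => k) (fun _ : Ω => k') = 0 := by
      unfold osCorr
      rw [integral_const, integral_const, integral_const, probReal_univ, one_smul, one_smul, one_smul]
      ring
    rw [h1, h2, h3]; ring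
  · obtain ⟨B, hB⟩ := hbY'
    exact ⟨B + ‖k'‖, fun ω => (norm_add_le _ _).trans (add_le_add (hB ω) le_rfl)⟩

/-- `osCorr` of real-valued observables (read in `ℂ`) is the real connected correlation
`∫ f(Θω) g(τω) dμ − (∫f)(∫g)`. [folklore] -/
theorem osCorr_ofReal (f g : Ω → ℝ) :
    osCorr μ Θ τ (fun ω => (f ω : ℂ)) (fun ω => (g ω : ℂ)) =
      (((∫ ω, f (Θ ω) * g (τ ω) ∂μ) - (∫ ω, f ω ∂μ) * ∫ ω, g ω ∂μ : ℝ) : ℂ) := by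
  unfold osCorr
  simp only [Complex.conj_ofReal, ← Complex.ofReal_mul, integral_complex_ofReal]
  push_cast; ring

end Constants

end Literature.MathematicalPhysics.QuantumLattice

end
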